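import Mathlib
import Summits.ValiantsHypothesis.ValiantsHypothesis.Theorems.ElementaryWordLengthWordLengthQPStubRealification
import Literature.Computability.AlgebraicComplexity.RealTauConjectureViaVnProofs
import Literature.Computability.AlgebraicComplexity.DetInVP

/-!
# Route SymmetroidDescartes — support `ThetaPencilWitness` (stmt-ValiantsHypothesis-18502), part 2:
the digit-grouped theta polynomial `Θ_ν`

Helper file for `Summit.ValiantsHypothesis.ValiantsHypothesis.Theses.SymmetroidDescartes.ThetaPencilWitness`.
Tavenas' Cor. 3.37 (tree theorem `Tavenas2014_cor_3_37_holds`) writes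
`V_ν(X) = h_ν(X^{2^0}, …, X^{2^{D-1}}; 2^{2^0}, …, 2^{2^{D-1}})` (`D = 2ν + 3`) for a multilinear
`h_ν ∈ ℚ[x_0, …, x_{D-1}, z_0, …, z_{D-1}]` that is a projection of `PER_{q(ν)}`.  Grouping the
bits `j = β i + s` (`0 ≤ s < β`) into base-`2^β` digits, i.e. substituting

  `x_0 ↦ -y_0`, `x_j ↦ y_{⌊j/β⌋}^{2^{j mod β}}` (`j ≥ 1`), `z_i ↦ 2^{2^i}`,

gives a polynomial `Θ_ν ∈ ℝ[y_0, …, y_{N-1}]` (`β N ≥ D`) in FEW variables with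
`Θ_ν(t^{2^{0}}, t^{2^{β}}, t^{2^{2β}}, …) = V_ν(-t)` for every real `t`
(`(-t)^{2^j} = t^{2^j}` for `j ≥ 1`), of circuit complexity `≤ L(h_ν) + 2D·2^β`
(Bürgisser's substitution bound `complexity_aeval_le`) and total degree `≤ 2^β · deg h_ν`.

Contents (all generic in the data; no definitions):
* `isPComputable_perPoly_real_of_complex` — realification, from the tree theorem
  `L_ℝ(per_n) ≤ 68 L_ℂ(per_n) + 6` (Hrubeš–Yehudayoff 2011, Thm 4.2, commutative case;
  `…PositiveMonoidExits.complexity_perPoly_real_le`, via `CommExtSim.complexity_lmap_le` for the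
  basis `{1, i}` and the functional `re`);
* `isProjection_map`, `complexity_pow_le`, `totalDegree_aeval_le_mul` — small algebra;
* `eval_map_tavenas_h` — `h_ν(x^{2^j}; 2^{2^i}) = V_ν(x)` over `ℝ`, from Cor. 3.37's identity
  over `ℚ`;
* `exists_theta` — the digit substitution and its three properties.

References: [Tavenas2014] Cor. 3.37, Lemme 3.36; [HrubesYehudayoff2011] Thm 4.2;
[Burgisser2000] Rem. 2.7.
-/

noncomputable section

-- single-conjunct layout: Sub = Summit, duplicated namespace component intended
set_option linter.dupNamespace false

namespace Summit.ValiantsHypothesis.ValiantsHypothesis.Theorems.SymmetroidDescartes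

open MvPolynomial Literature.Computability.AlgebraicComplexity

/-! ### Realification of the permanent's circuit complexity -/

/-- **`PER` p-computable over `ℂ` ⟹ `PER` p-computable over `ℝ`**: realification
`L_ℝ(per_n) ≤ 68 · L_ℂ(per_n) + 6` (Hrubeš–Yehudayoff 2011, Thm 4.2, commutative case, for
`ℂ/ℝ` of dimension `2`; tree theorem
`…Cruxes.WordLengthQP.PositiveMonoidExits.complexity_perPoly_real_le`, from
`CommExtSim.complexity_lmap_le` with `Complex.basisOneI`, `Complex.reLm`) is p-bounded with
`L_ℂ`. [cite: HrubesYehudayoff2011, Thm 4.2] -/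
theorem isPComputable_perPoly_real_of_complex (h : IsPComputable (fun n => perPoly (Fin n) ℂ)) :
    IsPComputable (fun n => perPoly (Fin n) ℝ) := by
  unfold IsPComputable at h ⊢
  refine IsPBounded.mono (t := fun n => 68 * complexity (perPoly (Fin n) ℂ) + 6) ?_ (fun n =>
    Summit.ValiantsHypothesis.ValiantsHypothesis.Cruxes.WordLengthQP.PositiveMonoidExits.complexity_perPoly_real_le
      n)
  exact IsPBounded.add_holds (IsPBounded.mul_holds (IsPBounded.const 68) h) (IsPBounded.const 6)

/-! ### Small algebra -/

/-- Projections are preserved by a change of coefficients: if `g = f(a)` with every `a i` a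
variable or a constant, then `φ g = (φ f)(φ a)` with `φ (X j) = X j`, `φ (C c) = C (φ c)`
(Bürgisser 2000, §4.1). [cite: Burgisser2000, §4.1] -/
theorem isProjection_map {k k' : Type*} [CommSemiring k] [CommSemiring k'] {σ τ : Type*}
    (φ : k →+* k') {g : MvPolynomial τ k} {f : MvPolynomial σ k} (hg : IsProjection g f) :
    IsProjection (MvPolynomial.map φ g) (MvPolynomial.map φ f) := by
  obtain ⟨a, ha, rfl⟩ := hg
  refine ⟨fun i => MvPolynomial.map φ (a i), fun i => ?_, ?_⟩
  · rcases ha i with ⟨j, hj⟩ | ⟨c, hc⟩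
    · exact Or.inl ⟨j, by simp only [hj, map_X]⟩
    · exact Or.inr ⟨φ c, by simp only [hc, map_C]⟩
  · rw [aeval_eq_bind₁, aeval_eq_bind₁]
    exact map_bind₁ φ a f

/-- Powers cost at most the exponent: `L(f^n) ≤ n · L(f) + n` (`n` product gates on `n` copies;
Bürgisser 2000, §2.1). [cite: Burgisser2000, §2.1] -/
theorem complexity_pow_le {k : Type*} [CommSemiring k] {σ : Type*} (f : MvPolynomial σ k) (n : ℕ) :
    complexity (f ^ n) ≤ n * complexity f + n := by
  rw [Finset.pow_eq_prod_const f n]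
  refine (complexity_finset_prod_le _ _).trans ?_
  rw [Finset.sum_const, Finset.card_range, smul_eq_mul]

/-- Total degree under substitution: if every `L i` has total degree `≤ D` then
`deg f(L) ≤ D · deg f`. [folklore] -/
theorem totalDegree_aeval_le_mul {R : Type*} [CommSemiring R] {σ τ : Type*}
    (L : σ → MvPolynomial τ R) (f : MvPolynomial σ R) {D : ℕ} (hL : ∀ i, (L i).totalDegree ≤ D) :
    (aeval L f).totalDegree ≤ D * f.totalDegree := by
  classical
  rw [aeval_eq_bind₁]
  conv_lhs => rw [f.as_sum]
  rw [map_sum]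
  refine totalDegree_finsetSum_le fun m hm => ?_
  rw [bind₁_monomial]
  refine (totalDegree_mul _ _).trans ?_
  rw [totalDegree_C, zero_add]
  refine (totalDegree_finsetProd _ _).trans ?_
  calc ∑ i ∈ m.support, (L i ^ m i).totalDegree
      ≤ ∑ i ∈ m.support, D * m i := Finset.sum_le_sum fun i _ =>
          (totalDegree_pow _ _).trans (by rw [mul_comm D]; exact Nat.mul_le_mul_left _ (hL i))
    _ = D * ∑ i ∈ m.support, m i := by rw [Finset.mul_sum]
    _ ≤ D * f.totalDegree := Nat.mul_le_mul_left _ (le_totalDegree hm)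

/-! ### Tavenas' identity over `ℝ` -/

/-- **`h_ν(x^{2^j}; 2^{2^i}) = V_ν(x)` over `ℝ`**: Cor. 3.37's identity
`h_ν(X^{2^j}; 2^{2^i}) = V_ν` in `ℚ[X]`, evaluated at a real point `x` (apply the `ℚ`-algebra
map `ℚ[X] → ℝ`, `X ↦ x`). [cite: Tavenas2014, Cor. 3.37] -/
theorem eval_map_tavenas_h {ν : ℕ} {h : MvPolynomial (Fin (2 * ν + 3) ⊕ Fin (2 * ν + 3)) ℚ}
    (hsub : MvPolynomial.aeval (kpSubst (2 * ν + 3) (2 * ν + 3)) h =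
      (tavenasV ν).map (Int.castRingHom ℚ)) (x : ℝ) :
    MvPolynomial.eval (Sum.elim (fun j : Fin (2 * ν + 3) => x ^ 2 ^ (j : ℕ))
        (fun i : Fin (2 * ν + 3) => (2 : ℝ) ^ 2 ^ (i : ℕ))) (MvPolynomial.map (algebraMap ℚ ℝ) h) =
      ((tavenasV ν).map (Int.castRingHom ℝ)).eval x := by
  have h1 := congr_arg (Polynomial.aeval x) hsub
  rw [comp_aeval_apply] at h1
  -- the right-hand side
  have hr : Polynomial.aeval x ((tavenasV ν).map (Int.castRingHom ℚ)) =
      ((tavenasV ν).map (Int.castRingHom ℝ)).eval x := by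
    rw [Polynomial.aeval_def, Polynomial.eval₂_eq_eval_map, Polynomial.map_map,
      RingHom.ext_int ((algebraMap ℚ ℝ).comp (Int.castRingHom ℚ)) (Int.castRingHom ℝ)]
  -- the left-hand side: the substituted values
  have hpt : (fun v => Polynomial.aeval x (kpSubst (2 * ν + 3) (2 * ν + 3) v)) =
      Sum.elim (fun j : Fin (2 * ν + 3) => x ^ 2 ^ (j : ℕ))
        (fun i : Fin (2 * ν + 3) => (2 : ℝ) ^ 2 ^ (i : ℕ)) := by
    funext v
    rcases v with j | i
    · simp [kpSubst]
    · simp [kpSubst]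
  rw [MvPolynomial.eval_map, ← MvPolynomial.aeval_def, ← hpt, h1, hr]

/-! ### The digit substitution -/

/-- **The theta polynomial.** For `β ≥ 1`, `N ≥ 1` with `β N ≥ D = 2ν + 3` and any
`H ∈ ℝ[x_0..x_{D-1}, z_0..z_{D-1}]` there is `Θ ∈ ℝ[y_0, …, y_{N-1}]` — namely
`Θ = H(x_0 := -y_0, x_j := y_{⌊j/β⌋}^{2^{j mod β}} (j ≥ 1), z_i := 2^{2^i})` — with
(i) `L(Θ) ≤ L(H) + 2D · 2^β` (Bürgisser's substitution bound: each substituted power costs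
`≤ 2^{j mod β} ≤ 2^β` gates), (ii) `deg Θ ≤ 2^β · deg H`, and (iii) for every real `t`,
`Θ(y_i := t^{2^{β i}}) = H(x_j := (-t)^{2^j}; z_i := 2^{2^i})`, because
`(t^{2^{β ⌊j/β⌋}})^{2^{j mod β}} = t^{2^j} = (-t)^{2^j}` for `j ≥ 1` and `-t^{2^0} = (-t)^{2^0}`.
[cite: Burgisser2000, Rem. 2.7] -/
theorem exists_theta {ν β N : ℕ} (hβ : 0 < β) (hN : 0 < N) (hD : 2 * ν + 3 ≤ β * N)
    (H : MvPolynomial (Fin (2 * ν + 3) ⊕ Fin (2 * ν + 3)) ℝ) :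
    ∃ Θ : MvPolynomial (Fin N) ℝ,
      complexity Θ ≤ complexity H + 2 * (2 * ν + 3) * 2 ^ β ∧
      Θ.totalDegree ≤ 2 ^ β * H.totalDegree ∧
      ∀ t : ℝ, MvPolynomial.eval (fun i : Fin N => t ^ 2 ^ (β * (i : ℕ))) Θ =
        MvPolynomial.eval (Sum.elim (fun j : Fin (2 * ν + 3) => (-t) ^ 2 ^ (j : ℕ))
          (fun i : Fin (2 * ν + 3) => (2 : ℝ) ^ 2 ^ (i : ℕ))) H := by
  -- the digit index is in range
  have hidx : ∀ j : Fin (2 * ν + 3), (j : ℕ) / β < N := fun j =>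
    (Nat.div_lt_iff_lt_mul hβ).2 (lt_of_lt_of_le j.2 (hD.trans_eq (Nat.mul_comm β N)))
  -- the substitution
  set g : Fin (2 * ν + 3) ⊕ Fin (2 * ν + 3) → MvPolynomial (Fin N) ℝ :=
    Sum.elim (fun j => if (j : ℕ) = 0 then -X ⟨0, hN⟩
        else X ⟨(j : ℕ) / β, hidx j⟩ ^ 2 ^ ((j : ℕ) % β))
      (fun i => C ((2 : ℝ) ^ 2 ^ (i : ℕ))) with hg
  have h2β : ∀ j : ℕ, 2 ^ (j % β) ≤ 2 ^ β := fun j =>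
    Nat.pow_le_pow_right (by norm_num) (Nat.mod_lt _ hβ).le
  refine ⟨aeval g H, ?_, ?_, ?_⟩
  · -- (i) complexity
    refine (complexity_aeval_le H g).trans (Nat.add_le_add_left ?_ _)
    have hle : ∀ v, complexity (g v) ≤ 2 ^ β := by
      intro v
      rcases v with j | i
      · simp only [hg, Sum.elim_inl]
        split_ifs with hj
        · refine (complexity_neg_le _).trans ?_
          rw [complexity_X_holds]
          exact Nat.one_le_two_pow
        · refine (complexity_pow_le _ _).trans ?_
          rw [complexity_X_holds, mul_zero, zero_add]
          exact h2β j
      · simp only [hg, Sum.elim_inr]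
        rw [complexity_C_holds]
        exact Nat.zero_le _
    calc ∑ v, complexity (g v) ≤ ∑ _v : Fin (2 * ν + 3) ⊕ Fin (2 * ν + 3), 2 ^ β :=
          Finset.sum_le_sum fun v _ => hle v
      _ = 2 * (2 * ν + 3) * 2 ^ β := by
          rw [Finset.sum_const, Finset.card_univ, Fintype.card_sum, Fintype.card_fin, smul_eq_mul]
          ring
  · -- (ii) degree
    refine totalDegree_aeval_le_mul g H (fun v => ?_)
    rcases v with j | i
    · simp only [hg, Sum.elim_inl]
      split_ifs
      · rw [totalDegree_neg, totalDegree_X]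
        exact Nat.one_le_two_pow
      · refine (totalDegree_pow _ _).trans ?_
        rw [totalDegree_X, mul_one]
        exact h2β j
    · simp only [hg, Sum.elim_inr, totalDegree_C]
      exact Nat.zero_le _
  · -- (iii) evaluation on the monomial curve
    intro t
    rw [aeval_eq_bind₁]
    have key : MvPolynomial.eval (fun i : Fin N => t ^ 2 ^ (β * (i : ℕ))) (bind₁ g H) =
        MvPolynomial.eval (fun v => MvPolynomial.eval (fun i : Fin N => t ^ 2 ^ (β * (i : ℕ))) (g v)) H :=
      eval₂Hom_bind₁ _ _ _ _
    have hfun : (fun v => MvPolynomial.eval (fun i : Fin N => t ^ 2 ^ (β * (i : ℕ))) (g v)) =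
        Sum.elim (fun j : Fin (2 * ν + 3) => (-t) ^ 2 ^ (j : ℕ))
          (fun i : Fin (2 * ν + 3) => (2 : ℝ) ^ 2 ^ (i : ℕ)) := by
      funext v
      rcases v with j | i
      · simp only [hg, Sum.elim_inl]
        split_ifs with hj
        · simp [hj]
        · rw [map_pow, eval_X, ← pow_mul, ← pow_add, Nat.div_add_mod (j : ℕ) β]
          exact (Even.neg_pow ((Nat.even_pow' hj).2 even_two) t).symm
      · simp [hg]
    rw [key, hfun]

end Summit.ValiantsHypothesis.ValiantsHypothesis.Theorems.SymmetroidDescartes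

end
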